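import Literature.Topology.FourManifolds.TubularSplitting
import Literature.Topology.FourManifolds.RechartOrientation
import Literature.Geometry.Manifold.OpenEmbeddingCriterion
import Literature.AlgebraicTopology.SingularHomology.PairTimesCircle
import Mathlib.Analysis.SpecialFunctions.Trigonometric.Arctan
import Mathlib.Analysis.SpecialFunctions.Trigonometric.ArctanDeriv
import HarnessLib

/-!
# The fibre `F × {pt}` of `F × T²` in tube coordinates

Topic `Literature/Topology/FourManifolds` (tube coordinates, `TubularSplitting.lean`; recharted
product models, `SignatureProductCircle.lean`, `RechartOrientation.lean`).  Written for the
Seiberg–Witten leaf `Literature.Barriers.SmoothPoincare4.akhmedovPark2010_lemma8_invariants`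
(A. Akhmedov, B. D. Park, Invent. Math. 181 (2010) 577–603, Lemma 8): the first building block of
`X₁(m) = Y₁(1,1) #_ψ Z''(1,m)` is the product `Σ₂ × T²` (§2, §9), the fibre sum of §9 being taken
along "`Σ₂ = Σ₂ × (½, ½) ⊂ Y₁(1/p, 1/q)`", the parallel genus-2 surface `Σ₂ × {pt}` with its
product tubular neighbourhood `Σ₂ × D²`.  In the tree's tube coordinates (a topological embedding
`T : F × ℝ² → Y` with a *tube function* `g`; `exists_tube_function`) this file PROVES, for every
closed connected smooth surface `F` (no definitions, no named facts):

* `exists_surface_prod_torus_tube` — there are a closed connected smooth `4`-manifold `X` charted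
  on `ℝ⁴` (Mathlib's product manifold `(F × S¹) × S¹` recharted twice along linear isomorphisms,
  exactly as in `exists_surface_prod_torus_model`), a homeomorphism `e : X ≃ₜ (F × S¹) × S¹`, a
  tube `T : F × ℝ² → X` with a tube function `g` (regular level `¼`, the three tube identities)
  whose position is read through `e` — `e (T (p, v)) = ((p, exp(i·arctan v₀)), exp(i·arctan v₁))`,
  so `range T = {x | Re (e x).1.2 > 0 ∧ Re (e x).2 > 0}` — together with the numbers of `X`: all
  `ℤ`-orientations have signature `0` (`signature_prodCircle_eq_zero`), `X` is `ℤ`-orientable if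
  `F` is (`isOrientableOver_int_rechart_prod_circle`), and `e(X) = 0` with finitely generated
  homology (`FinRelHomology.prod_torus`).
* The tube is the smooth open embedding `(p, v) ↦ (p, exp(i arctan v₀), exp(i arctan v₁))`
  (`isSmoothEmbedding_of_leftInverse_of_isOpenMap` with the left inverse
  `z ↦ Im z / Re z = tan (arg z)` on the half circles `Re z > 0`), and `exists_tube_function`.
* `exists_surface_prod_torus_smooth_tube` — the same statement with the tube exported as a
  smooth embedding for the product model `(𝓡 2).prod (𝓡 2)` with open range (the hypothesis of
  `exists_tube_function` and of the fibre-sum construction of `TubeFibreSum.lean`);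
  `exists_surface_prod_torus_tube` is its corollary;
* `exists_surface_prod_torus_smooth_model` — the same with, moreover, `e` smooth in both
  directions (a diffeomorphism onto Mathlib's product manifold `(F × S¹) × S¹`), through which
  further tubes are placed in the same `X`.

What is NOT here: the Lagrangian tori `a₁′ × c′, b₁′ × c″, a₂′ × c′, a₂″ × d′` of Akhmedov–Park
eq. (9.1) (tubes of tori built from curves in `Σ₂ = T² # T²`), the second block `T⁴ # ℂℙ²bar` with
`Σ̄₂` (§3), `π₁`, Seiberg–Witten.

## References

* A. Akhmedov, B. D. Park, *Exotic smooth structures on small 4-manifolds with odd signatures*,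
  Invent. Math. 181 (2010) 577–603, §2, §9. [AkhmedovPark2010]
* J. M. Lee, *Introduction to Smooth Manifolds*, 2nd ed., GTM 218 (2013), Prop. 5.2 (smooth
  embeddings), Example 1.8 / Prop. 1.17 (compatible atlases). [LeeSmoothManifolds2013]
* R. C. Kirby, *The Topology of 4-Manifolds*, LNM 1374 (1989), Ch. II §5 p. 27 (`σ(M³ × S¹) = 0`).
  [Kirby1989]
-/

noncomputable section

open scoped Manifold ContDiff Topology Real
open Set Function Topology
open Literature.AlgebraicTopology.SingularHomology
open Literature.Geometry.Manifold (Rechart)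

namespace Literature.Topology.FourManifolds

/-! ### The half-circle parametrisation `t ↦ exp(i arctan t)` -/

section Arc

/-- `exp(i arctan t)` has real part `cos (arctan t) > 0`. [folklore] -/
theorem re_circleExp_arctan_pos (t : ℝ) : 0 < ((Circle.exp (Real.arctan t) : Circle) : ℂ).re := by
  rw [Circle.coe_exp, Complex.exp_ofReal_mul_I_re]
  exact Real.cos_arctan_pos t

/-- `Im / Re` of `exp(i arctan t)` is `tan (arctan t) = t`: the left inverse. [folklore] -/
theorem im_div_re_circleExp_arctan (t : ℝ) :
    ((Circle.exp (Real.arctan t) : Circle) : ℂ).im / ((Circle.exp (Real.arctan t) : Circle) : ℂ).re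
      = t := by
  rw [Circle.coe_exp, Complex.exp_ofReal_mul_I_re, Complex.exp_ofReal_mul_I_im,
    ← Real.tan_eq_sin_div_cos, Real.tan_arctan]

/-- `t ↦ exp(i arctan t)` is injective. [folklore] -/
theorem injective_circleExp_arctan : Injective fun t : ℝ => Circle.exp (Real.arctan t) := by
  intro s t h
  have := congrArg (fun z : Circle => (z : ℂ).im / (z : ℂ).re) h
  simpa only [im_div_re_circleExp_arctan] using this

/-- `t ↦ exp(i arctan t)` is smooth. [folklore] -/
theorem contMDiff_circleExp_arctan :
    ContMDiff 𝓘(ℝ, ℝ) (𝓡 1) ∞ fun t : ℝ => Circle.exp (Real.arctan t) :=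
  contMDiff_circleExp.comp Real.contDiff_arctan.contMDiff

/-- `t ↦ exp(i arctan t)` is an open map (`arctan` is a homeomorphism onto an open interval and
`exp` is a local homeomorphism). [folklore] -/
theorem isOpenMap_circleExp_arctan : IsOpenMap fun t : ℝ => Circle.exp (Real.arctan t) := by
  have h1 : IsOpenMap Real.arctan := by
    have : Real.arctan = (Subtype.val : Ioo (-(π / 2)) (π / 2) → ℝ) ∘ Real.tanOrderIso.symm := by
      funext t; rfl
    rw [this]
    exact isOpen_Ioo.isOpenMap_subtype_val.comp Real.tanOrderIso.symm.toHomeomorph.isOpenMap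
  exact isLocalHomeomorph_circleExp.isOpenMap.comp h1

/-- A point of the circle with positive real part is `exp(i arctan t)` for `t = Im z / Re z`.
[folklore] -/
theorem circleExp_arctan_im_div_re {z : Circle} (hz : 0 < (z : ℂ).re) :
    Circle.exp (Real.arctan ((z : ℂ).im / (z : ℂ).re)) = z := by
  have habs : |Complex.arg (z : ℂ)| < π / 2 := Complex.abs_arg_lt_pi_div_two_iff.2 (Or.inl hz)
  have harg : Real.arctan ((z : ℂ).im / (z : ℂ).re) = Complex.arg (z : ℂ) := by
    rw [← Complex.tan_arg, Real.arctan_tan (abs_lt.1 habs).1 (abs_lt.1 habs).2]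
  rw [harg, Circle.exp_arg]

end Arc

/-! ### The model `(F × S¹) × S¹` recharted on `ℝ⁴`, with the tube of the fibre -/

section Model

/-- **The smooth model `X ≅ (F × S¹) × S¹` with the fibre tube, the diffeomorphism `e` and the
numbers** — the statement of `exists_surface_prod_torus_smooth_tube` (below) with, in addition,
the smoothness of `e : X ≃ₜ (F × S¹) × S¹` in both directions for Mathlib's product model
`((𝓡 2).prod (𝓡 1)).prod (𝓡 1)` (`Rechart.contMDiff_out`/`contMDiff_into`): `e` is a
diffeomorphism, through which further tubes (the Lagrangian tori of Akhmedov–Park's eq. (9.1))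
are placed in the SAME `X`. [cite: AkhmedovPark2010, §2 and §9] [cite: LeeSmoothManifolds2013, Prop. 5.2] [cite: Kirby1989, Ch. II §5 p. 27] -/
theorem exists_surface_prod_torus_smooth_model (F : Type) [TopologicalSpace F] [T2Space F]
    [SecondCountableTopology F] [CompactSpace F] [ConnectedSpace F]
    [ChartedSpace (EuclideanSpace ℝ (Fin 2)) F] [IsManifold (𝓡 2) ∞ F] :
    ∃ (X : Type) (_ : TopologicalSpace X) (_ : T2Space X) (_ : SecondCountableTopology X)
      (_ : ChartedSpace (EuclideanSpace ℝ (Fin 4)) X) (_ : IsManifold (𝓡 4) ∞ X)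
      (_ : CompactSpace X) (_ : ConnectedSpace X) (e : X ≃ₜ (F × Circle) × Circle)
      (T : F × EuclideanSpace ℝ (Fin 2) → X) (g : X → ℝ),
      (Manifold.IsSmoothEmbedding ((𝓡 2).prod (𝓡 2)) (𝓡 4) ∞ T ∧ IsOpen (range T) ∧
        IsRegularLevel (𝓡 4) g (1 / 4) ∧
        (∀ x, g (T x) ≤ 1 / 4 ↔ ‖x.2‖ ≤ 1 / 2) ∧ (∀ x, g (T x) < 1 / 4 ↔ ‖x.2‖ < 1 / 2) ∧
        (∀ y, y ∉ range T → g y = 1)) ∧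
      (ContMDiff (𝓡 4) (((𝓡 2).prod (𝓡 1)).prod (𝓡 1)) ∞ e ∧
        ContMDiff (((𝓡 2).prod (𝓡 1)).prod (𝓡 1)) (𝓡 4) ∞ e.symm) ∧
      (∀ (p : F) (v : EuclideanSpace ℝ (Fin 2)),
        e (T (p, v)) = ((p, Circle.exp (Real.arctan (v 0))), Circle.exp (Real.arctan (v 1)))) ∧
      (∀ x, x ∈ range T ↔ 0 < (((e x).1.2 : Circle) : ℂ).re ∧ 0 < (((e x).2 : Circle) : ℂ).re) ∧
      (∀ μ : HomologicalOrientation ℤ X 4, μ.signature = 0) ∧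
      (IsOrientableOver ℤ F 2 → IsOrientableOver ℤ X 4) ∧
      (∀ N, FinRelHomology ℤ ℤ F ∅ N → FinRelHomology ℤ ℤ X ∅ (N + 2) ∧ relEuler ℤ ℤ X ∅ = 0) := by
  haveI : Nonempty F := ConnectedSpace.toNonempty
  -- the recharts `N = F × S¹` on `ℝ³`, `X = N × S¹` on `ℝ⁴`
  let L₃ : (EuclideanSpace ℝ (Fin 2) × EuclideanSpace ℝ (Fin 1)) ≃L[ℝ] EuclideanSpace ℝ (Fin 3) :=
    ContinuousLinearEquiv.ofFinrankEq (by simp)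
  let f₃ : ModelProd (EuclideanSpace ℝ (Fin 2)) (EuclideanSpace ℝ (Fin 1)) ≃ₜ
      EuclideanSpace ℝ (Fin 3) := L₃.toHomeomorph
  have hIf₃ : ∀ x, f₃ x = L₃ (((𝓡 2).prod (𝓡 1)) x) := fun x => rfl
  have hf₃ := Rechart.contMDiff_of_apply_eq_linear (I := (𝓡 2).prod (𝓡 1)) (n := ∞) f₃ L₃ hIf₃
  have hf₃' := Rechart.contMDiff_symm_of_apply_eq_linear (I := (𝓡 2).prod (𝓡 1)) (n := ∞) f₃ L₃
    hIf₃
  haveI hN : IsManifold (𝓡 3) ∞ (Rechart f₃ (F × Circle)) := Rechart.isManifold f₃ _ hf₃ hf₃'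
  haveI : SecondCountableTopology (Rechart f₃ (F × Circle)) :=
    inferInstanceAs (SecondCountableTopology (F × Circle))
  haveI : ConnectedSpace (Rechart f₃ (F × Circle)) := inferInstanceAs (ConnectedSpace (F × Circle))
  let L₄ : (EuclideanSpace ℝ (Fin 3) × EuclideanSpace ℝ (Fin 1)) ≃L[ℝ] EuclideanSpace ℝ (Fin 4) :=
    ContinuousLinearEquiv.ofFinrankEq (by simp)
  let f₄ : ModelProd (EuclideanSpace ℝ (Fin 3)) (EuclideanSpace ℝ (Fin 1)) ≃ₜ
      EuclideanSpace ℝ (Fin 4) := L₄.toHomeomorph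
  have hIf₄ : ∀ x, f₄ x = L₄ (((𝓡 3).prod (𝓡 1)) x) := fun x => rfl
  have hf₄ := Rechart.contMDiff_of_apply_eq_linear (I := (𝓡 3).prod (𝓡 1)) (n := ∞) f₄ L₄ hIf₄
  have hf₄' := Rechart.contMDiff_symm_of_apply_eq_linear (I := (𝓡 3).prod (𝓡 1)) (n := ∞) f₄ L₄
    hIf₄
  haveI hX : IsManifold (𝓡 4) ∞ (Rechart f₄ (Rechart f₃ (F × Circle) × Circle)) :=
    Rechart.isManifold f₄ _ hf₄ hf₄'
  haveI : SecondCountableTopology (Rechart f₄ (Rechart f₃ (F × Circle) × Circle)) :=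
    inferInstanceAs (SecondCountableTopology (Rechart f₃ (F × Circle) × Circle))
  haveI : ConnectedSpace (Rechart f₄ (Rechart f₃ (F × Circle) × Circle)) :=
    inferInstanceAs (ConnectedSpace (Rechart f₃ (F × Circle) × Circle))
  -- notation
  let into₃ := Rechart.into f₃ (F × Circle)
  let out₃ := Rechart.out f₃ (F × Circle)
  let into₄ := Rechart.into f₄ (Rechart f₃ (F × Circle) × Circle)
  let out₄ := Rechart.out f₄ (Rechart f₃ (F × Circle) × Circle)
  let e : Rechart f₄ (Rechart f₃ (F × Circle) × Circle) ≃ₜ (F × Circle) × Circle :=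
    (Rechart.outHomeomorph f₄ _).trans
      ((Rechart.outHomeomorph f₃ _).prodCongr (Homeomorph.refl Circle))
  let ε : ℝ → Circle := fun t => Circle.exp (Real.arctan t)
  let ℓ : Circle → ℝ := fun z => (z : ℂ).im / (z : ℂ).re
  let e₀ : EuclideanSpace ℝ (Fin 2) := EuclideanSpace.single 0 1
  let e₁ : EuclideanSpace ℝ (Fin 2) := EuclideanSpace.single 1 1
  let toE : ℝ → ℝ → EuclideanSpace ℝ (Fin 2) := fun a b => a • e₀ + b • e₁
  have htoE0 : ∀ a b, toE a b 0 = a := fun a b => by simp [toE, e₀, e₁]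
  have htoE1 : ∀ a b, toE a b 1 = b := fun a b => by simp [toE, e₀, e₁]
  have htoE : ∀ v : EuclideanSpace ℝ (Fin 2), toE (v 0) (v 1) = v := fun v => by
    ext i
    fin_cases i
    · exact htoE0 _ _
    · exact htoE1 _ _
  -- the tube and its left inverse
  let T : F × EuclideanSpace ℝ (Fin 2) → Rechart f₄ (Rechart f₃ (F × Circle) × Circle) :=
    fun x => into₄ (into₃ (x.1, ε (x.2 0)), ε (x.2 1))
  let finv : Rechart f₄ (Rechart f₃ (F × Circle) × Circle) → F × EuclideanSpace ℝ (Fin 2) :=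
    fun x => ((e x).1.1, toE (ℓ (e x).1.2) (ℓ (e x).2))
  have heT : ∀ (p : F) (v : EuclideanSpace ℝ (Fin 2)), e (T (p, v)) = ((p, ε (v 0)), ε (v 1)) :=
    fun p v => rfl
  have hleft : ∀ x, finv (T x) = x := by
    rintro ⟨p, v⟩
    show ((e (T (p, v))).1.1, toE (ℓ (e (T (p, v))).1.2) (ℓ (e (T (p, v))).2)) = (p, v)
    rw [heT]
    simp only [ℓ, ε, im_div_re_circleExp_arctan, htoE]
  have hinj : Injective T := fun x y h => by rw [← hleft x, ← hleft y, h]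
  -- smoothness of `T`
  have hε : ContMDiff 𝓘(ℝ, ℝ) (𝓡 1) ∞ ε := contMDiff_circleExp_arctan
  have hproj : ∀ i : Fin 2, ContMDiff (𝓡 2) 𝓘(ℝ, ℝ) ∞ (fun v : EuclideanSpace ℝ (Fin 2) => v i) :=
    fun i => (EuclideanSpace.proj (𝕜 := ℝ) (ι := Fin 2) i).contMDiff
  have hv0 : ContMDiff ((𝓡 2).prod (𝓡 2)) 𝓘(ℝ, ℝ) ∞
      (fun x : F × EuclideanSpace ℝ (Fin 2) => x.2 0) := (hproj 0).comp contMDiff_snd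
  have hv1 : ContMDiff ((𝓡 2).prod (𝓡 2)) 𝓘(ℝ, ℝ) ∞
      (fun x : F × EuclideanSpace ℝ (Fin 2) => x.2 1) := (hproj 1).comp contMDiff_snd
  have hinto₃ : ContMDiff ((𝓡 2).prod (𝓡 1)) (𝓡 3) ∞ into₃ := Rechart.contMDiff_into f₃ _ hf₃ hf₃'
  have hinto₄ : ContMDiff ((𝓡 3).prod (𝓡 1)) (𝓡 4) ∞ into₄ := Rechart.contMDiff_into f₄ _ hf₄ hf₄'
  have hout₃ : ContMDiff (𝓡 3) ((𝓡 2).prod (𝓡 1)) ∞ out₃ := Rechart.contMDiff_out f₃ _ hf₃ hf₃'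
  have hout₄ : ContMDiff (𝓡 4) ((𝓡 3).prod (𝓡 1)) ∞ out₄ := Rechart.contMDiff_out f₄ _ hf₄ hf₄'
  have hTsm : ContMDiff ((𝓡 2).prod (𝓡 2)) (𝓡 4) ∞ T :=
    hinto₄.comp ((hinto₃.comp (contMDiff_fst.prodMk (hε.comp hv0))).prodMk (hε.comp hv1))
  -- `T` is an open map
  have hopen : IsOpenMap T := by
    let πE : EuclideanSpace ℝ (Fin 2) ≃ₜ ℝ × ℝ :=
      (EuclideanSpace.equiv (Fin 2) ℝ).toHomeomorph.trans (Homeomorph.piFinTwo fun _ => ℝ)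
    have hE₂ : IsOpenMap fun v : EuclideanSpace ℝ (Fin 2) => (ε (v 0), ε (v 1)) := by
      have : (fun v : EuclideanSpace ℝ (Fin 2) => (ε (v 0), ε (v 1))) = Prod.map ε ε ∘ πE := by
        funext v; rfl
      rw [this]
      exact (isOpenMap_circleExp_arctan.prodMap isOpenMap_circleExp_arctan).comp πE.isOpenMap
    have hS : IsOpenMap fun x : F × EuclideanSpace ℝ (Fin 2) => ((x.1, ε (x.2 0)), ε (x.2 1)) := by
      have : (fun x : F × EuclideanSpace ℝ (Fin 2) => ((x.1, ε (x.2 0)), ε (x.2 1))) =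
          (Homeomorph.prodAssoc F Circle Circle).symm ∘
            Prod.map id (fun v : EuclideanSpace ℝ (Fin 2) => (ε (v 0), ε (v 1))) := by
        funext x; rfl
      rw [this]
      exact (Homeomorph.prodAssoc F Circle Circle).symm.isOpenMap.comp (IsOpenMap.id.prodMap hE₂)
    have : T = e.symm ∘ fun x : F × EuclideanSpace ℝ (Fin 2) => ((x.1, ε (x.2 0)), ε (x.2 1)) := by
      funext x
      apply e.injective
      rw [comp_apply, Homeomorph.apply_symm_apply]
      rfl
    rw [this]
    exact e.symm.isOpenMap.comp hS
  -- the left inverse is smooth on the range (where both circle coordinates have `Re > 0`)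
  have he_sm : ContMDiff (𝓡 4) (((𝓡 2).prod (𝓡 1)).prod (𝓡 1)) ∞ e :=
    (hout₃.prodMap contMDiff_id).comp hout₄
  haveI hC : Fact (Module.finrank ℝ ℂ = 1 + 1) := finrank_real_complex_fact'
  have hcoe : ContMDiff (𝓡 1) 𝓘(ℝ, ℂ) ∞ (fun z : Circle => (z : ℂ)) := contMDiff_coe_sphere
  have hre : ContMDiff (𝓡 1) 𝓘(ℝ, ℝ) ∞ fun z : Circle => (z : ℂ).re :=
    Complex.reCLM.contMDiff.comp hcoe
  have him : ContMDiff (𝓡 1) 𝓘(ℝ, ℝ) ∞ fun z : Circle => (z : ℂ).im :=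
    Complex.imCLM.contMDiff.comp hcoe
  have hℓ : ContMDiffOn (𝓡 1) 𝓘(ℝ, ℝ) ∞ ℓ {z : Circle | 0 < (z : ℂ).re} :=
    him.contMDiffOn.div₀ hre.contMDiffOn fun z hz => ne_of_gt hz
  have hrange_re : ∀ x ∈ range T, 0 < (((e x).1.2 : Circle) : ℂ).re ∧ 0 < (((e x).2 : Circle) : ℂ).re := by
    rintro _ ⟨⟨p, v⟩, rfl⟩
    rw [heT]
    exact ⟨re_circleExp_arctan_pos _, re_circleExp_arctan_pos _⟩
  have hz₁ : ContMDiff (𝓡 4) (𝓡 1) ∞ fun x => ((e x).1.2 : Circle) :=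
    contMDiff_snd.comp (contMDiff_fst.comp he_sm)
  have hz₂ : ContMDiff (𝓡 4) (𝓡 1) ∞ fun x => ((e x).2 : Circle) := contMDiff_snd.comp he_sm
  have hℓ₁ : ContMDiffOn (𝓡 4) 𝓘(ℝ, ℝ) ∞ (fun x => ℓ (e x).1.2) (range T) :=
    hℓ.comp hz₁.contMDiffOn fun x hx => (hrange_re x hx).1
  have hℓ₂ : ContMDiffOn (𝓡 4) 𝓘(ℝ, ℝ) ∞ (fun x => ℓ (e x).2) (range T) :=
    hℓ.comp hz₂.contMDiffOn fun x hx => (hrange_re x hx).2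
  have hfinv : ContMDiffOn (𝓡 4) ((𝓡 2).prod (𝓡 2)) ∞ finv (range T) := by
    refine (contMDiff_fst.comp (contMDiff_fst.comp he_sm)).contMDiffOn.prodMk ?_
    exact (hℓ₁.smul contMDiffOn_const).add (hℓ₂.smul contMDiffOn_const)
  -- so `T` is a smooth open embedding, and has a tube function
  let L : (EuclideanSpace ℝ (Fin 2) × EuclideanSpace ℝ (Fin 2)) ≃L[ℝ] EuclideanSpace ℝ (Fin 4) :=
    ContinuousLinearEquiv.ofFinrankEq (by simp)
  obtain ⟨hemb, hopenRange⟩ :=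
    Literature.Geometry.Manifold.isSmoothEmbedding_of_leftInverse_of_isOpenMap
      (IY := (𝓡 2).prod (𝓡 2)) (I := 𝓡 4) hTsm hinj
      hopen hfinv hleft L
  obtain ⟨g, hreg, hle, hlt, hout⟩ := exists_tube_function (k := 3) hemb hopenRange
  -- the range of `T`
  have hrange : ∀ x, x ∈ range T ↔ 0 < (((e x).1.2 : Circle) : ℂ).re ∧ 0 < (((e x).2 : Circle) : ℂ).re := by
    intro x
    refine ⟨hrange_re x, fun ⟨h₁, h₂⟩ => ⟨((e x).1.1, toE (ℓ (e x).1.2) (ℓ (e x).2)), e.injective ?_⟩⟩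
    rw [heT, htoE0, htoE1]
    simp only [ε, ℓ, circleExp_arctan_im_div_re h₁, circleExp_arctan_im_div_re h₂]
  -- the numbers: `σ = 0`, orientability, `e = 0`
  have hσ : ∀ μ : HomologicalOrientation ℤ (Rechart f₄ (Rechart f₃ (F × Circle) × Circle)) 4,
      μ.signature = 0 := fun μ => signature_prodCircle_eq_zero f₄ L₄ (fun _ => rfl) μ
  have hO : IsOrientableOver ℤ F 2 →
      IsOrientableOver ℤ (Rechart f₄ (Rechart f₃ (F × Circle) × Circle)) 4 := by
    intro hF
    have hF' : IsOrientable (𝓡 2) F := isOrientable_of_isOrientableOver_int F hF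
    have hN' : IsOrientable (𝓡 3) (Rechart f₃ (F × Circle)) :=
      IsOrientable.rechart f₃ L₃ (F × Circle) hIf₃ (hF'.prod isOrientable_circle)
    exact isOrientableOver_int_rechart_prod_circle (Rechart f₃ (F × Circle)) hN' f₄ L₄ hIf₄
  have hfin : ∀ N, FinRelHomology ℤ ℤ F ∅ N →
      FinRelHomology ℤ ℤ (Rechart f₄ (Rechart f₃ (F × Circle) × Circle)) ∅ (N + 2) ∧
        relEuler ℤ ℤ (Rechart f₄ (Rechart f₃ (F × Circle) × Circle)) ∅ = 0 := by
    intro N hF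
    let eC : Circle ≃ₜ AddCircle (1 : ℝ) := (AddCircle.homeomorphCircle one_ne_zero).symm
    let e' : Rechart f₄ (Rechart f₃ (F × Circle) × Circle) ≃ₜ
        F × (AddCircle (1 : ℝ) × AddCircle (1 : ℝ)) :=
      (e.trans (((Homeomorph.refl F).prodCongr eC).prodCongr eC)).trans
        (Homeomorph.prodAssoc F (AddCircle (1 : ℝ)) (AddCircle (1 : ℝ)))
    obtain ⟨hfinT, heT'⟩ := FinRelHomology.prod_torus ℤ ℤ hF
    refine ⟨hfinT.of_homeomorph e'.symm (fun _ hx => False.elim hx) (fun _ hx => False.elim hx),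
      ?_⟩
    rw [← heT']
    exact relEuler_eq_of_homeomorph (R := ℤ) (M := ℤ)
      (A := (∅ : Set (Rechart f₄ (Rechart f₃ (F × Circle) × Circle)))) e'
      (fun _ hx => False.elim hx) (fun _ hx => False.elim hx)
  -- `e⁻¹ = into₄ ∘ (into₃ × id)` is smooth
  have he_symm : ContMDiff (((𝓡 2).prod (𝓡 1)).prod (𝓡 1)) (𝓡 4) ∞ e.symm := by
    have : (⇑e.symm : (F × Circle) × Circle → Rechart f₄ (Rechart f₃ (F × Circle) × Circle)) =
        fun y => into₄ (into₃ y.1, y.2) := by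
      funext y; rfl
    rw [this]
    exact hinto₄.comp ((hinto₃.comp contMDiff_fst).prodMk contMDiff_snd)
  exact ⟨Rechart f₄ (Rechart f₃ (F × Circle) × Circle), inferInstance, inferInstance, inferInstance,
    inferInstance, hX, inferInstance, inferInstance, e, T, g,
    ⟨hemb, hopenRange, hreg, hle, hlt, hout⟩, ⟨he_sm, he_symm⟩, heT, hrange, hσ, hO, hfin⟩

/-- **The fibre `F × {pt} ⊂ F × T²` in SMOOTH tube coordinates, with the numbers of `F × T²`.**
The statement of `exists_surface_prod_torus_tube` (below) with the tube `T : F × ℝ² → X` exported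
as what it is in the construction: a smooth embedding for Mathlib's product model
`(𝓡 2).prod (𝓡 2)` with open range (`isSmoothEmbedding_of_leftInverse_of_isOpenMap`) — the form
of tube consumed by the fibre-sum construction `exists_fibreSum_boundaryGluingData`
(`TubeFibreSum.lean`) and by `exists_tube_function` (`TubularSplitting.lean`).  For a closed
connected smooth surface `F`: a closed connected smooth `4`-manifold `X` charted on `ℝ⁴` with
`e : X ≃ₜ (F × S¹) × S¹`, the smooth open tube `T` with a tube function `g`, the formula
`e (T (p, v)) = ((p, e^{i arctan v₀}), e^{i arctan v₁})`, `range T = {Re (e x).1.2 > 0,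
Re (e x).2 > 0}`, and the numbers `σ = 0` (all `ℤ`-orientations), `ℤ`-orientability from that
of `F`, `e(X) = 0` with finitely generated homology.  In Akhmedov–Park 2010 this is the surface
"`Σ₂ = Σ₂ × (½, ½)`" of §9 in `Σ₂ × T²`.
[cite: AkhmedovPark2010, §2 and §9] [cite: LeeSmoothManifolds2013, Prop. 5.2] [cite: Kirby1989, Ch. II §5 p. 27] -/
theorem exists_surface_prod_torus_smooth_tube (F : Type) [TopologicalSpace F] [T2Space F]
    [SecondCountableTopology F] [CompactSpace F] [ConnectedSpace F]
    [ChartedSpace (EuclideanSpace ℝ (Fin 2)) F] [IsManifold (𝓡 2) ∞ F] :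
    ∃ (X : Type) (_ : TopologicalSpace X) (_ : T2Space X) (_ : SecondCountableTopology X)
      (_ : ChartedSpace (EuclideanSpace ℝ (Fin 4)) X) (_ : IsManifold (𝓡 4) ∞ X)
      (_ : CompactSpace X) (_ : ConnectedSpace X) (e : X ≃ₜ (F × Circle) × Circle)
      (T : F × EuclideanSpace ℝ (Fin 2) → X) (g : X → ℝ),
      (Manifold.IsSmoothEmbedding ((𝓡 2).prod (𝓡 2)) (𝓡 4) ∞ T ∧ IsOpen (range T) ∧
        IsRegularLevel (𝓡 4) g (1 / 4) ∧
        (∀ x, g (T x) ≤ 1 / 4 ↔ ‖x.2‖ ≤ 1 / 2) ∧ (∀ x, g (T x) < 1 / 4 ↔ ‖x.2‖ < 1 / 2) ∧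
        (∀ y, y ∉ range T → g y = 1)) ∧
      (∀ (p : F) (v : EuclideanSpace ℝ (Fin 2)),
        e (T (p, v)) = ((p, Circle.exp (Real.arctan (v 0))), Circle.exp (Real.arctan (v 1)))) ∧
      (∀ x, x ∈ range T ↔ 0 < (((e x).1.2 : Circle) : ℂ).re ∧ 0 < (((e x).2 : Circle) : ℂ).re) ∧
      (∀ μ : HomologicalOrientation ℤ X 4, μ.signature = 0) ∧
      (IsOrientableOver ℤ F 2 → IsOrientableOver ℤ X 4) ∧
      (∀ N, FinRelHomology ℤ ℤ F ∅ N → FinRelHomology ℤ ℤ X ∅ (N + 2) ∧ relEuler ℤ ℤ X ∅ = 0) := by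
  obtain ⟨X, _, _, _, _, hX, _, _, e, T, g, hT, -, heT, hrange, hσ, hO, hfin⟩ :=
    exists_surface_prod_torus_smooth_model F
  exact ⟨X, inferInstance, inferInstance, inferInstance, inferInstance, hX, inferInstance,
    inferInstance, e, T, g, hT, heT, hrange, hσ, hO, hfin⟩

/-- **The fibre `F × {pt} ⊂ F × T²` in tube coordinates, with the numbers of `F × T²`.**  For a
closed connected smooth surface `F` there are a closed connected smooth `4`-manifold `X` charted on
`ℝ⁴` with a homeomorphism `e : X ≃ₜ (F × S¹) × S¹` (Mathlib's product manifold recharted, as in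
`exists_surface_prod_torus_model`), a tube `T : F × ℝ² → X` (a topological embedding) with a tube
function `g` (`IsRegularLevel ¼`, `{g ∘ T ≤ ¼} = {‖v‖ ≤ ½}`, `{g ∘ T < ¼} = {‖v‖ < ½}`, `g ≡ 1`
off the tube; `exists_tube_function`) sitting over the half circles,
`e (T (p, v)) = ((p, e^{i arctan v₀}), e^{i arctan v₁})`,
`range T = {Re (e x).1.2 > 0, Re (e x).2 > 0}`; and: every `ℤ`-orientation of `X` has signature
`0` (`signature_prodCircle_eq_zero`), `X` is `ℤ`-orientable when `F` is
(`isOrientableOver_int_rechart_prod_circle`), and `H_•(X)` is finitely generated with `e(X) = 0`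
when `H_•(F)` is finitely generated (`FinRelHomology.prod_torus`).  In Akhmedov–Park 2010 this is
the surface "`Σ₂ = Σ₂ × (½, ½)`" of §9 in `Σ₂ × T²` with `e(Σ₂ × T²) = 0`, `σ(Σ₂ × T²) = 0`.
[cite: AkhmedovPark2010, §2 and §9] [cite: LeeSmoothManifolds2013, Prop. 5.2] [cite: Kirby1989, Ch. II §5 p. 27] -/
theorem exists_surface_prod_torus_tube (F : Type) [TopologicalSpace F] [T2Space F]
    [SecondCountableTopology F] [CompactSpace F] [ConnectedSpace F]
    [ChartedSpace (EuclideanSpace ℝ (Fin 2)) F] [IsManifold (𝓡 2) ∞ F] :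
    ∃ (X : Type) (_ : TopologicalSpace X) (_ : T2Space X) (_ : SecondCountableTopology X)
      (_ : ChartedSpace (EuclideanSpace ℝ (Fin 4)) X) (_ : IsManifold (𝓡 4) ∞ X)
      (_ : CompactSpace X) (_ : ConnectedSpace X) (e : X ≃ₜ (F × Circle) × Circle)
      (T : F × EuclideanSpace ℝ (Fin 2) → X) (g : X → ℝ),
      (Topology.IsEmbedding T ∧ IsRegularLevel (𝓡 4) g (1 / 4) ∧
        (∀ x, g (T x) ≤ 1 / 4 ↔ ‖x.2‖ ≤ 1 / 2) ∧ (∀ x, g (T x) < 1 / 4 ↔ ‖x.2‖ < 1 / 2) ∧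
        (∀ y, y ∉ range T → g y = 1)) ∧
      (∀ (p : F) (v : EuclideanSpace ℝ (Fin 2)),
        e (T (p, v)) = ((p, Circle.exp (Real.arctan (v 0))), Circle.exp (Real.arctan (v 1)))) ∧
      (∀ x, x ∈ range T ↔ 0 < (((e x).1.2 : Circle) : ℂ).re ∧ 0 < (((e x).2 : Circle) : ℂ).re) ∧
      (∀ μ : HomologicalOrientation ℤ X 4, μ.signature = 0) ∧
      (IsOrientableOver ℤ F 2 → IsOrientableOver ℤ X 4) ∧
      (∀ N, FinRelHomology ℤ ℤ F ∅ N → FinRelHomology ℤ ℤ X ∅ (N + 2) ∧ relEuler ℤ ℤ X ∅ = 0) := by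
  obtain ⟨X, _, _, _, _, hX, _, _, e, T, g, ⟨hemb, -, hreg, hle, hlt, hout⟩, heT, hrange, hσ, hO,
    hfin⟩ := exists_surface_prod_torus_smooth_tube F
  exact ⟨X, inferInstance, inferInstance, inferInstance, inferInstance, hX, inferInstance,
    inferInstance, e, T, g, ⟨hemb.isEmbedding, hreg, hle, hlt, hout⟩, heT, hrange, hσ, hO, hfin⟩

end Model

end Literature.Topology.FourManifolds

end
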